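import Summits.BirchSwinnertonDyer.BirchSwinnertonDyer.Theorems.ResidualThetaTransportAtTwoThetaLayerLambdaCongruenceAtTwoHeckeAdjointHeckeOnPeriods
import HarnessLib

/-!
# Crux Kan⁺ `ThetaLayerLambdaCongruenceAtTwo` (stmt-BirchSwinnertonDyer-20688), line `birth` v14, SD floor, Hecke clause — brick «HA8a»:
# the PERMUTATION COCYCLES of the Hecke representatives `(1 j; 0 p)`, `diag(p,1)` on `Γ₀(N)`, as INTEGER matrix equations
# (width seat bsd-wall-rtt-p3-w4 g7; `--supports stmt-BirchSwinnertonDyer-20688`; THEOREMS ONLY — no `def`, no named fact, no `sorry`)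

HONEST FRAMING. Elementary THEOREMS about `2×2` integer matrices and `Γ₀(N)`; nothing about any curve is asserted; nothing here settles Kan⁺;
BSD is not proved by any of this.

WHAT. For a prime `p`, `γ ∈ Γ₀(N)` and the right-coset representatives `R_p` of `Γ₀(N) diag(1,p) Γ₀(N)` — `M_j = (1 j; 0 p)`, `0 ≤ j < p`,
plus `M_∞ = diag(p,1)` when `p ∤ N` — there are a PERMUTATION `σ` of the index set (`Fin p`, resp. `Option (Fin p)` with `none ↦ diag(p,1)`) and
`δ_i ∈ Γ₀(N)` with the COCYCLE EQUATIONS `M_i · γ = δ_i · M_{σ i}` in `M₂(ℤ)` (`exists_heckeCocycle_fin` for `p ∣ N`, `exists_heckeCocycle_option`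
for `p ∤ N`) — the input shape of rtt-p3-w3 g11's `sum_dualChainVec_anchor` (`{ι} [Fintype ι] (σ : Equiv.Perm ι) (δ : ι → Gamma0 N)`) and of
rtt-p3-w2 g8's `flatMap_reexpansion_isManinChain` / lead g13's `exists_maninChains_of_cocycle` (`hcoc : M * ↑γ = ↑δ * Mσ`). Existence and the
permutation property are TRANSPORTED from the tree's coset decomposition in `GL(2, ℝ)` (`existsUnique_fin`, `existsUnique_option`,
`tpB_mem_doubleCoset`, `tpD_mem_doubleCoset`, Diamond–Shurman (5.2) / Ex. 5.2.4) to integer matrices. LINK to the Hecke action on `Λ`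
(`heckeT_smul_periodFunctional_eq_sum_cocycle_fin/option`): with these `δ`'s, `T_p • ⟨{∞, γ∞}⟩ = Σ_i ⟨{∞, δ_i ∞}⟩` in `periodHomologyHecke N`
(rtt-p3-w4 g7's `heckeT_smul_periodFunctional_eq_sum_of_cusps` + `cusps_of_cocycle_tpB/tpD`).

References: F. Diamond, J. Shurman (2005) (5.2), Prop. 5.2.1, Ex. 5.2.4 [DiamondShurman2005]; J. E. Cremona (1997) §2.4 [CremonaAlgorithms1997];
L. Merel (1995) §2.1 [Merel1995Homologie].
-/

set_option autoImplicit false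
-- justification: the `Summit.BirchSwinnertonDyer.BirchSwinnertonDyer.…` path repeats a component (route-file convention)
set_option linter.dupNamespace false

noncomputable section

open scoped MatrixGroups ModularForm

open CongruenceSubgroup Matrix.SpecialLinearGroup ModularGroup
open Literature.NumberTheory.EllipticCurves Literature.NumberTheory.EllipticCurves.ModularForms

namespace Summit.BirchSwinnertonDyer.BirchSwinnertonDyer.Theorems.ThetaLayerLambdaCongruenceAtTwo

/-! ## §1 Transport between `GL(2, ℝ)` and integer matrices -/

section Transport

variable {N : ℕ} {p : ℕ} [NeZero p]

/-- The real matrix of `tpB p j = (1 j; 0 p)` is the cast of the integer matrix `!![1, j; 0, p]`. [folklore] -/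
theorem val_tpB_eq_map (j : ℤ) :
    ((tpB p j : GL (Fin 2) ℝ) : Matrix (Fin 2) (Fin 2) ℝ) = (!![(1 : ℤ), j; 0, (p : ℤ)]).map (Int.castRingHom ℝ) := by
  rw [val_tpB]
  ext a b
  fin_cases a <;> fin_cases b <;> simp

/-- The real matrix of `tpD p = diag(p, 1)` is the cast of the integer matrix `!![p, 0; 0, 1]`. [folklore] -/
theorem val_tpD_eq_map :
    ((tpD p : GL (Fin 2) ℝ) : Matrix (Fin 2) (Fin 2) ℝ) = (!![(p : ℤ), 0; 0, 1]).map (Int.castRingHom ℝ) := by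
  rw [val_tpD]
  ext a b
  fin_cases a <;> fin_cases b <;> simp

/-- **Integer cocycle equation from a `GL(2, ℝ)` equation**: if `δ · G_k = G_i · γ` in `GL(2, ℝ)` with `G_i`, `G_k` the casts of integer
matrices `M_i`, `M_k` and `γ, δ ∈ SL₂(ℤ)`, then `M_i γ = δ M_k` in `M₂(ℤ)`. [folklore] -/
theorem intMatrix_cocycle_of_gl {γ δ : SL(2, ℤ)} {Mi Mk : Matrix (Fin 2) (Fin 2) ℤ} {Gi Gk : GL (Fin 2) ℝ}
    (hGi : (Gi : Matrix (Fin 2) (Fin 2) ℝ) = Mi.map (Int.castRingHom ℝ))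
    (hGk : (Gk : Matrix (Fin 2) (Fin 2) ℝ) = Mk.map (Int.castRingHom ℝ))
    (h : Matrix.SpecialLinearGroup.mapGL ℝ δ * Gk = Gi * Matrix.SpecialLinearGroup.mapGL ℝ γ) :
    Mi * (γ : Matrix (Fin 2) (Fin 2) ℤ) = (δ : Matrix (Fin 2) (Fin 2) ℤ) * Mk := by
  have hval := congrArg (fun A : GL (Fin 2) ℝ ↦ (A : Matrix (Fin 2) (Fin 2) ℝ)) h
  simp only [Matrix.GeneralLinearGroup.coe_mul, hGi, hGk, val_mapGL'] at hval
  ext a b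
  have e := congrFun (congrFun hval a) b
  simp only [Matrix.mul_apply, Fin.sum_univ_two, Matrix.map_apply, Int.coe_castRingHom] at e
  simp only [Matrix.mul_apply, Fin.sum_univ_two]
  exact_mod_cast e.symm

/-- Right multiplication by `γ ∈ Γ₀(N)` preserves the double coset `Γ₀(N) g Γ₀(N) ⊆ GL(2, ℝ)`. [folklore] -/
theorem mul_mapGL_mem_doubleCoset {g x : GL (Fin 2) ℝ}
    (hx : x ∈ DoubleCoset.doubleCoset g (((Gamma0 N : Subgroup SL(2, ℤ)) : Subgroup (GL (Fin 2) ℝ)) : Set (GL (Fin 2) ℝ))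
      (((Gamma0 N : Subgroup SL(2, ℤ)) : Subgroup (GL (Fin 2) ℝ)) : Set (GL (Fin 2) ℝ)))
    (γ : Gamma0 N) :
    x * Matrix.SpecialLinearGroup.mapGL ℝ (γ : SL(2, ℤ)) ∈
      DoubleCoset.doubleCoset g (((Gamma0 N : Subgroup SL(2, ℤ)) : Subgroup (GL (Fin 2) ℝ)) : Set (GL (Fin 2) ℝ))
        (((Gamma0 N : Subgroup SL(2, ℤ)) : Subgroup (GL (Fin 2) ℝ)) : Set (GL (Fin 2) ℝ)) := by
  obtain ⟨x₁, hx₁, x₂, hx₂, rfl⟩ := DoubleCoset.mem_doubleCoset.mp hx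
  refine DoubleCoset.mem_doubleCoset.mpr ⟨x₁, hx₁, x₂ * Matrix.SpecialLinearGroup.mapGL ℝ (γ : SL(2, ℤ)),
    mul_mem hx₂ (Subgroup.mem_map_of_mem _ γ.2), by simp only [mul_assoc]⟩

/-- From `x · G⁻¹ ∈ Γ₀(N)` (in `GL(2, ℝ)`) to `δ · G = x` for some `δ ∈ Γ₀(N)`. [folklore] -/
theorem exists_gamma0_mul_eq_of_mul_inv_mem {x G : GL (Fin 2) ℝ}
    (h : x * G⁻¹ ∈ ((Gamma0 N : Subgroup SL(2, ℤ)) : Subgroup (GL (Fin 2) ℝ))) :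
    ∃ δ : Gamma0 N, Matrix.SpecialLinearGroup.mapGL ℝ ((δ : Gamma0 N) : SL(2, ℤ)) * G = x := by
  obtain ⟨d, hd, hdeq⟩ := Subgroup.mem_map.mp h
  exact ⟨⟨d, hd⟩, by rw [hdeq, inv_mul_cancel_right]⟩

end Transport

/-! ## §2 The permutation cocycle, `p ∣ N` (representatives `(1 j; 0 p)`, `j mod p`) -/

section DividesLevel

variable (N : ℕ) {p : ℕ} (hp : p.Prime)
include hp

/-- **Hecke cocycle for `p ∣ N`.** For `γ ∈ Γ₀(N)` there are a permutation `σ` of `Fin p` and `δ_j ∈ Γ₀(N)` with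
`(1 j; 0 p) · γ = δ_j · (1 σj; 0 p)` in `M₂(ℤ)` for every `j` (the right cosets `Γ₀(N)(1 j; 0 p)` exhaust `Γ₀(N) diag(1,p) Γ₀(N)` when `p ∣ N`,
Diamond–Shurman Ex. 5.2.4; `σ` is injective because distinct representatives lie in distinct cosets). [cite: DiamondShurman2005, (5.2) and Ex. 5.2.4] -/
theorem exists_heckeCocycle_fin (hpN : p ∣ N) (γ : Gamma0 N) :
    ∃ (σ : Equiv.Perm (Fin p)) (δ : Fin p → Gamma0 N), ∀ j : Fin p,
      !![(1 : ℤ), ((j : ℕ) : ℤ); 0, (p : ℤ)] * ((γ : SL(2, ℤ)) : Matrix (Fin 2) (Fin 2) ℤ) =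
        (((δ j : Gamma0 N) : SL(2, ℤ)) : Matrix (Fin 2) (Fin 2) ℤ) * !![(1 : ℤ), (((σ j : Fin p) : ℕ) : ℤ); 0, (p : ℤ)] := by
  haveI : NeZero p := ⟨hp.ne_zero⟩
  haveI : Fact p.Prime := ⟨hp⟩
  -- `x_j := (1 j; 0 p) γ` lies in the double coset; its unique coset index is `f j`
  have hx : ∀ j : Fin p, tpB p ((j : ℕ) : ℤ) * Matrix.SpecialLinearGroup.mapGL ℝ (γ : SL(2, ℤ)) ∈
      DoubleCoset.doubleCoset (tpG p) (((Gamma0 N : Subgroup SL(2, ℤ)) : Subgroup (GL (Fin 2) ℝ)) : Set (GL (Fin 2) ℝ))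
        (((Gamma0 N : Subgroup SL(2, ℤ)) : Subgroup (GL (Fin 2) ℝ)) : Set (GL (Fin 2) ℝ)) :=
    fun j ↦ mul_mapGL_mem_doubleCoset (tpB_mem_doubleCoset p N ((j : ℕ) : ℤ)) γ
  have hu := fun j : Fin p ↦ existsUnique_fin p N hpN _ (hx j)
  choose f hf hfu using hu
  -- `f` is injective: two representatives in the same coset coincide
  have hinj : Function.Injective f := by
    intro j₁ j₂ h12
    have h1 := hf j₁
    have h2 := hf j₂
    rw [← h12] at h2
    -- `(x₁ β⁻¹) (x₂ β⁻¹)⁻¹ = tpB j₁ · tpB j₂⁻¹ ∈ Γ₀(N)`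
    have hmem : tpB p ((j₁ : ℕ) : ℤ) * (tpB p ((j₂ : ℕ) : ℤ))⁻¹ ∈
        ((Gamma0 N : Subgroup SL(2, ℤ)) : Subgroup (GL (Fin 2) ℝ)) := by
      have h := mul_mem h1 (inv_mem h2)
      have e : tpB p ((j₁ : ℕ) : ℤ) * Matrix.SpecialLinearGroup.mapGL ℝ (γ : SL(2, ℤ)) * (tpB p (((f j₁ : Fin p) : ℕ) : ℤ))⁻¹ *
          (tpB p ((j₂ : ℕ) : ℤ) * Matrix.SpecialLinearGroup.mapGL ℝ (γ : SL(2, ℤ)) * (tpB p (((f j₁ : Fin p) : ℕ) : ℤ))⁻¹)⁻¹ =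
          tpB p ((j₁ : ℕ) : ℤ) * (tpB p ((j₂ : ℕ) : ℤ))⁻¹ := by
        group
      rwa [e] at h
    -- uniqueness for `x = tpB j₁` (indices `j₁` and `j₂` both work)
    obtain ⟨k, -, hku⟩ := existsUnique_fin p N hpN _ (tpB_mem_doubleCoset p N ((j₁ : ℕ) : ℤ))
    have e1 : j₁ = k := hku j₁ (by beta_reduce; rw [mul_inv_cancel]; exact one_mem _)
    have e2 : j₂ = k := hku j₂ hmem
    rw [e1, e2]
  let σ : Equiv.Perm (Fin p) := Equiv.ofBijective f hinj.bijective_of_finite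
  -- the cocycle elements
  have hδ := fun j : Fin p ↦ exists_gamma0_mul_eq_of_mul_inv_mem (hf j)
  choose δ hδ using hδ
  refine ⟨σ, δ, fun j ↦ ?_⟩
  have hσj : σ j = f j := rfl
  rw [hσj]
  exact intMatrix_cocycle_of_gl (val_tpB_eq_map (p := p) ((j : ℕ) : ℤ)) (val_tpB_eq_map (p := p) (((f j : Fin p) : ℕ) : ℤ)) (hδ j)

/-- **The Hecke action on `Λ` through the cocycle, `p ∣ N`**: with `σ`, `δ` as in `exists_heckeCocycle_fin`,
`U_p • ⟨{∞, γ∞}⟩ = Σ_j ⟨{∞, δ_j∞}⟩` in `periodHomologyHecke N` (the `δ_j` have the cusps `(γ∞ + j)/p`, `cusps_of_cocycle_tpB`).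
[cite: CremonaAlgorithms1997, §2.4 (2.4.1)–(2.4.2)] [cite: DiamondShurman2005, Prop. 5.2.1] -/
theorem heckeT_smul_periodFunctional_eq_sum_cocycle_fin [NeZero N] (hpN : p ∣ N) (γ : Gamma0 N)
    (σ : Equiv.Perm (Fin p)) (δ : Fin p → Gamma0 N)
    (hcoc : ∀ j : Fin p,
      !![(1 : ℤ), ((j : ℕ) : ℤ); 0, (p : ℤ)] * ((γ : SL(2, ℤ)) : Matrix (Fin 2) (Fin 2) ℤ) =
        (((δ j : Gamma0 N) : SL(2, ℤ)) : Matrix (Fin 2) (Fin 2) ℤ) * !![(1 : ℤ), (((σ j : Fin p) : ℕ) : ℤ); 0, (p : ℤ)]) :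
    HeckeRing0.T N 2 p hp • (⟨periodFunctional N γ, periodFunctional_mem_periodHomology N γ⟩ : periodHomologyHecke N) =
      ∑ j : Fin p, (⟨periodFunctional N (δ j), periodFunctional_mem_periodHomology N (δ j)⟩ : periodHomologyHecke N) := by
  have hcusp := fun j : Fin p ↦
    cusps_of_cocycle_tpB hp (γ := (γ : SL(2, ℤ))) (δ := ((δ j : Gamma0 N) : SL(2, ℤ)))
      (Mσ := !![(1 : ℤ), (((σ j : Fin p) : ℕ) : ℤ); 0, (p : ℤ)]) ((j : ℕ) : ℤ) rfl (by simp) (hcoc j)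
  rw [heckeT_smul_periodFunctional_eq_sum_of_cusps N hp γ δ 1 (fun j ↦ (hcusp j).1) (fun j ↦ (hcusp j).2)
    (fun h ↦ (h hpN).elim) (fun h ↦ (h hpN).elim), if_pos hpN, add_zero]

end DividesLevel

/-! ## §3 The permutation cocycle, `p ∤ N` (representatives `(1 j; 0 p)`, `j mod p`, and `diag(p,1)`) -/

section PrimeToLevel

variable (N : ℕ) {p : ℕ} (hp : p.Prime)
include hp

/-- **Hecke cocycle for `p ∤ N`.** Index set `Option (Fin p)`: `some j ↦ M_j = (1 j; 0 p)`, `none ↦ M_∞ = diag(p, 1)`. For `γ ∈ Γ₀(N)` there are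
a permutation `σ` of `Option (Fin p)` and `δ_i ∈ Γ₀(N)` with `M_i · γ = δ_i · M_{σ i}` in `M₂(ℤ)` for every `i` (Diamond–Shurman (5.2): the
`p + 1` right cosets of `Γ₀(N) diag(1,p) Γ₀(N)`). [cite: DiamondShurman2005, (5.2) and Prop. 5.2.1] -/
theorem exists_heckeCocycle_option (hpN : ¬ p ∣ N) (γ : Gamma0 N) :
    ∃ (σ : Equiv.Perm (Option (Fin p))) (δ : Option (Fin p) → Gamma0 N), ∀ i : Option (Fin p),
      (i.elim !![(p : ℤ), 0; 0, 1] fun j ↦ !![(1 : ℤ), ((j : ℕ) : ℤ); 0, (p : ℤ)]) * ((γ : SL(2, ℤ)) : Matrix (Fin 2) (Fin 2) ℤ) =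
        (((δ i : Gamma0 N) : SL(2, ℤ)) : Matrix (Fin 2) (Fin 2) ℤ) *
          ((σ i).elim !![(p : ℤ), 0; 0, 1] fun j ↦ !![(1 : ℤ), ((j : ℕ) : ℤ); 0, (p : ℤ)]) := by
  haveI : NeZero p := ⟨hp.ne_zero⟩
  haveI : Fact p.Prime := ⟨hp⟩
  -- the representatives in `GL(2, ℝ)` and their integer matrices
  have hval : ∀ i : Option (Fin p), (((i.elim (tpD p) fun j ↦ tpB p ((j : ℕ) : ℤ)) : GL (Fin 2) ℝ) : Matrix (Fin 2) (Fin 2) ℝ) =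
      (i.elim !![(p : ℤ), 0; 0, 1] fun j ↦ !![(1 : ℤ), ((j : ℕ) : ℤ); 0, (p : ℤ)]).map (Int.castRingHom ℝ) := by
    rintro (_ | j)
    · exact val_tpD_eq_map
    · exact val_tpB_eq_map ((j : ℕ) : ℤ)
  have hrep : ∀ i : Option (Fin p), (i.elim (tpD p) fun j ↦ tpB p ((j : ℕ) : ℤ)) ∈
      DoubleCoset.doubleCoset (tpG p) (((Gamma0 N : Subgroup SL(2, ℤ)) : Subgroup (GL (Fin 2) ℝ)) : Set (GL (Fin 2) ℝ))
        (((Gamma0 N : Subgroup SL(2, ℤ)) : Subgroup (GL (Fin 2) ℝ)) : Set (GL (Fin 2) ℝ)) := by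
    rintro (_ | j)
    · exact tpD_mem_doubleCoset p N hpN
    · exact tpB_mem_doubleCoset p N ((j : ℕ) : ℤ)
  have hx : ∀ i : Option (Fin p), (i.elim (tpD p) fun j ↦ tpB p ((j : ℕ) : ℤ)) * Matrix.SpecialLinearGroup.mapGL ℝ (γ : SL(2, ℤ)) ∈
      DoubleCoset.doubleCoset (tpG p) (((Gamma0 N : Subgroup SL(2, ℤ)) : Subgroup (GL (Fin 2) ℝ)) : Set (GL (Fin 2) ℝ))
        (((Gamma0 N : Subgroup SL(2, ℤ)) : Subgroup (GL (Fin 2) ℝ)) : Set (GL (Fin 2) ℝ)) :=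
    fun i ↦ mul_mapGL_mem_doubleCoset (hrep i) γ
  have hu := fun i : Option (Fin p) ↦ existsUnique_option p N _ (hx i)
  choose f hf hfu using hu
  have hinj : Function.Injective f := by
    intro i₁ i₂ h12
    have h1 := hf i₁
    have h2 := hf i₂
    rw [← h12] at h2
    have hmem : (i₁.elim (tpD p) fun j ↦ tpB p ((j : ℕ) : ℤ)) * ((i₂.elim (tpD p) fun j ↦ tpB p ((j : ℕ) : ℤ)))⁻¹ ∈
        ((Gamma0 N : Subgroup SL(2, ℤ)) : Subgroup (GL (Fin 2) ℝ)) := by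
      have h := mul_mem h1 (inv_mem h2)
      have e : (i₁.elim (tpD p) fun j ↦ tpB p ((j : ℕ) : ℤ)) * Matrix.SpecialLinearGroup.mapGL ℝ (γ : SL(2, ℤ)) *
            (((f i₁).elim (tpD p) fun j ↦ tpB p ((j : ℕ) : ℤ)))⁻¹ *
          ((i₂.elim (tpD p) fun j ↦ tpB p ((j : ℕ) : ℤ)) * Matrix.SpecialLinearGroup.mapGL ℝ (γ : SL(2, ℤ)) *
            (((f i₁).elim (tpD p) fun j ↦ tpB p ((j : ℕ) : ℤ)))⁻¹)⁻¹ =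
          (i₁.elim (tpD p) fun j ↦ tpB p ((j : ℕ) : ℤ)) * ((i₂.elim (tpD p) fun j ↦ tpB p ((j : ℕ) : ℤ)))⁻¹ := by
        group
      rwa [e] at h
    obtain ⟨k, -, hku⟩ := existsUnique_option p N _ (hrep i₁)
    have e1 : i₁ = k := hku i₁ (by beta_reduce; rw [mul_inv_cancel]; exact one_mem _)
    have e2 : i₂ = k := hku i₂ hmem
    rw [e1, e2]
  let σ : Equiv.Perm (Option (Fin p)) := Equiv.ofBijective f hinj.bijective_of_finite
  have hδ := fun i : Option (Fin p) ↦ exists_gamma0_mul_eq_of_mul_inv_mem (hf i)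
  choose δ hδ using hδ
  refine ⟨σ, δ, fun i ↦ ?_⟩
  have hσi : σ i = f i := rfl
  rw [hσi]
  exact intMatrix_cocycle_of_gl (hval i) (hval (f i)) (hδ i)

/-- **The Hecke action on `Λ` through the cocycle, `p ∤ N`**: with `σ`, `δ` as in `exists_heckeCocycle_option`,
`T_p • ⟨{∞, γ∞}⟩ = Σ_{i : Option (Fin p)} ⟨{∞, δ_i∞}⟩ = Σ_j ⟨{∞, δ_j∞}⟩ + ⟨{∞, δ_∞ ∞}⟩` in `periodHomologyHecke N`
(cusps `(γ∞ + j)/p` and `pγ∞`, `cusps_of_cocycle_tpB/tpD`). [cite: CremonaAlgorithms1997, §2.4 (2.4.1)–(2.4.2)] [cite: DiamondShurman2005, Prop. 5.2.1] -/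
theorem heckeT_smul_periodFunctional_eq_sum_cocycle_option [NeZero N] (hpN : ¬ p ∣ N) (γ : Gamma0 N)
    (σ : Equiv.Perm (Option (Fin p))) (δ : Option (Fin p) → Gamma0 N)
    (hcoc : ∀ i : Option (Fin p),
      (i.elim !![(p : ℤ), 0; 0, 1] fun j ↦ !![(1 : ℤ), ((j : ℕ) : ℤ); 0, (p : ℤ)]) * ((γ : SL(2, ℤ)) : Matrix (Fin 2) (Fin 2) ℤ) =
        (((δ i : Gamma0 N) : SL(2, ℤ)) : Matrix (Fin 2) (Fin 2) ℤ) *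
          ((σ i).elim !![(p : ℤ), 0; 0, 1] fun j ↦ !![(1 : ℤ), ((j : ℕ) : ℤ); 0, (p : ℤ)])) :
    HeckeRing0.T N 2 p hp • (⟨periodFunctional N γ, periodFunctional_mem_periodHomology N γ⟩ : periodHomologyHecke N) =
      ∑ i : Option (Fin p), (⟨periodFunctional N (δ i), periodFunctional_mem_periodHomology N (δ i)⟩ : periodHomologyHecke N) := by
  have hpz : (p : ℤ) ≠ 0 := by exact_mod_cast hp.ne_zero
  -- upper-triangularity data of the target representative `M_{σ i}`
  have h10 : ∀ i : Option (Fin p), (i.elim !![(p : ℤ), 0; 0, 1] fun j ↦ !![(1 : ℤ), ((j : ℕ) : ℤ); 0, (p : ℤ)]) 1 0 = 0 := by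
    rintro (_ | j) <;> rfl
  have h00 : ∀ i : Option (Fin p), (i.elim !![(p : ℤ), 0; 0, 1] fun j ↦ !![(1 : ℤ), ((j : ℕ) : ℤ); 0, (p : ℤ)]) 0 0 ≠ 0 := by
    rintro (_ | j)
    · exact hpz
    · exact one_ne_zero
  have hB := fun j : Fin p ↦
    cusps_of_cocycle_tpB hp (γ := (γ : SL(2, ℤ))) (δ := ((δ (some j) : Gamma0 N) : SL(2, ℤ)))
      (Mσ := (σ (some j)).elim !![(p : ℤ), 0; 0, 1] fun j ↦ !![(1 : ℤ), ((j : ℕ) : ℤ); 0, (p : ℤ)]) ((j : ℕ) : ℤ)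
      (h10 _) (h00 _) (hcoc (some j))
  have hD := cusps_of_cocycle_tpD (p := p) (γ := (γ : SL(2, ℤ))) (δ := ((δ none : Gamma0 N) : SL(2, ℤ)))
      (Mσ := (σ none).elim !![(p : ℤ), 0; 0, 1] fun j ↦ !![(1 : ℤ), ((j : ℕ) : ℤ); 0, (p : ℤ)]) (h10 _) (h00 _) (hcoc none)
  rw [heckeT_smul_periodFunctional_eq_sum_of_cusps N hp γ (fun j ↦ δ (some j)) (δ none) (fun j ↦ (hB j).1) (fun j ↦ (hB j).2)
    (fun _ ↦ hD.1) (fun _ ↦ hD.2), if_neg hpN, Fintype.sum_option, add_comm]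

end PrimeToLevel

end Summit.BirchSwinnertonDyer.BirchSwinnertonDyer.Theorems.ThetaLayerLambdaCongruenceAtTwo

end
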